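import Summits.CriticalPhenomena.SAWScalingLimit.Theses.SAWReversalUpgrade
import Summits.CriticalPhenomena.SAWScalingLimit.Theorems.NoDeepReturn.Negative.SAWReversalUpgradeEndpointLoadBearing
import Summits.CriticalPhenomena.SAWScalingLimit.Theorems.NoDeepReturn.Negative.SAWReversalUpgradeOrderScaleMesh
import Literature.Probability.RandomPlanarGeometry.SAWScalingLimitFamily
import HarnessLib

/-!
# Disproof of `NoDeepReturn` (stmt-CriticalPhenomena-18004, route `SAWReversalUpgrade`) — findings

Standing disprover's work file (`cdisprove`, cycle 1, 2026-08-17). Crux, verbatim shape: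

    ∀ D a b, SAW.IsEndpointApprox D a b → ∀ ε > 0, ∀ η > 0, ∃ r > 0, ∀ᶠ δ in 𝓝[>] 0,
      law D.carrier δ (a δ) (b δ) {γ | ∃ s < t, ε ≤ dist (poly γ s) (D.pt 0) ∧ dist (poly γ t) (D.pt 0) ≤ r} ≤ ofReal η

## INDEX OF FINDINGS

0. **No kill short of the conjunct.** `SAWScalingLimit → NoDeepReturn` is kernel-checked
   (`Cruxes/NoDeepReturn/NoDeepReturnNecessary.lean`, strategist seat, rc 0, 0 sorry: closed
   far-then-near event in `CurveClass ℂ` + SLE₈⸝₃ simple and rooted at `a` + portmanteau). A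
   refutation of the crux for ANY admissible `(D, a_δ, b_δ)` refutes Lawler–Schramm–Werner on `δℤ²`
   as formalised. Every witness class tried against the crux itself needs a `δ`-uniform LOWER bound
   on a boundary-approach event of the `x_c`-SAW (§6), absent and contrary to prediction.
1. **(a) Load-bearing hypotheses — ALL LANDED as `Theorems/NoDeepReturn/Negative/*`** (§1 restates):
   endpoint LIMITS of `IsEndpointApprox` (`…EndpointLoadBearing`, earlier seat); time order `s < t`,
   `0 < ε` (`…OrderScaleMesh`, this seat, p159167). `reachable` and `tendsto_fst` ALONE are NOT
   load-bearing for truth (dropping `reachable` only adds junk-law cases `law = 0`; with `a_δ → a' ≠ a`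
   the statement becomes "no close approach of a THIRD boundary point", also predicted true,
   boundary one-arm exponent 2) — information, not a lemma.
2. **(b) Tightness** (landed, `r_lt_dist_of_noDeepReturnBound`): any admissible `r` is `< dist a b`.
3. **(c) Natural strengthenings**: `∃ r ∀ ε` FALSE (landed); `∀ δ > 0` instead of `∀ᶠ δ` FALSE
   (landed, unit disc, meshes `δ ∈ [1/4,1/2)`); `r` uniform over `(D, a, b)` (census S⁺₁) FALSE on
   paper — fjord family, §3 (`sorry`: formalisation cost only); `∃ r ∀ η` (= `P_δ(F_{ε,r}) → 0` for a
   FIXED `r`) predicted false (returns below a fixed `r` keep SLE-probability `P(F_r) > 0`) but needs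
   a lower bound — same class as the crux, not attackable.
4. **(d) Targets**: none registered (payload `targets = ∅`, no skeleton registered yet).
5. **(e) PICKED line `SketchIdeator2` (idea `naked-root-localisation`)** — §5: its atom
   `RootLocalisation` is PREDICTED FALSE AS TYPED for EVERY admissible `(D, a)` (not a degenerate
   geometry artefact): `y` ranges over the whole Stolz entrance set INCLUDING ITS RIM `|δy − a| ≈ ρ`,
   and `confSet` pins the remainder inside `B̄(a, ρ)` (kernel fact `confSet_stolzReach_subset_ball`),
   so `C(y)/Z(y) ≲ (δ/ρ)^{x₁ᵇ−x₁} = (δ/ρ)^{25/48} → 0` (half-plane start penalty, `γ₁ = 61/64` vs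
   `γ = 43/32`) while `F(y)/Z(y) → p(ρ/ε) > 0`; hence `F(y) > η C(y)` for small `δ`, every `ρ`.
   The two-radii Stolz repair is still predicted false (non-tangential confinement down to the root
   costs `(d₀/ρ)^{c(κ)}`, `c(κ) > 0`, over `log(ρ/d₀)` scales); the fat repair (confine to
   `D ∩ B̄(a,2ρ)`) is plausible but destroys the free prefix-avoidance of `FirstEntranceFarBound`
   (prefix vertices in `B(a,2ρ) ∖ A`) — obstruction (α) of the census returns. `FirstEntranceFarBound`
   itself checks TRUE on paper (first-entrance bijection); `CollarReturnAvoidance` is a sub-event of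
   the crux. Posted to the lead as `stub-misstated: RootLocalisation`.
6. **Why it resists** (for provers) — end of file.

Prose lives in docstrings; `sorry` appears ONLY in §3 (S⁺₁, formalisation cost) and §5 (heuristic,
not kernel-provable with present tools), each with the obstruction stated.
-/

noncomputable section

namespace Summit.CriticalPhenomena.SAWScalingLimit.Cruxes.NoDeepReturn.Disproof

open MeasureTheory Filter Topology Set Metric
open scoped NNReal ENNReal
open Literature.Probability.RandomPlanarGeometry
open Literature.Probability.RandomPlanarGeometry.SAW
open Literature.Probability.LatticeModels (Site meshPoint discreteDomainGraph meshDomain)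
open Summit.CriticalPhenomena.SAWScalingLimit.Theorems.NoDeepReturn.Negative

/-- The crux, by name. -/
abbrev Crux : Prop := Summit.CriticalPhenomena.SAWScalingLimit.Theses.SAWReversalUpgrade.NoDeepReturn

/-- The crux's deep-return event of the polyline at mesh `δ` (radius `r`, scale `ε`, centre `c`),
for SAWs between arbitrary lattice endpoints. -/
def deepReturn (Ω : Set ℂ) (δ : ℝ) (u v : Site 2) (c : ℂ) (ε r : ℝ) : Set (DomainSAW Ω δ u v) :=
  {γ | ∃ s t : unitInterval, s < t ∧ ε ≤ dist (γ.walk.toCurve (meshPoint δ) s) c ∧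
    dist (γ.walk.toCurve (meshPoint δ) t) c ≤ r}

/-- The crux unfolds to the `deepReturn` event (by `rfl`). -/
theorem crux_iff : Crux ↔ ∀ (D : DobrushinDomain) (a b : ℝ → Site 2), IsEndpointApprox D a b →
    ∀ ε : ℝ, 0 < ε → ∀ η : ℝ, 0 < η → ∃ r : ℝ, 0 < r ∧ ∀ᶠ δ in 𝓝[>] (0 : ℝ),
      law D.carrier δ (a δ) (b δ) (deepReturn D.carrier δ (a δ) (b δ) (D.pt 0) ε r)
        ≤ ENNReal.ofReal η :=
  Iff.rfl

/-! ## §1 (a) Load-bearing hypotheses (all kernel-checked, all landed under `Negative/`) -/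

/-- The crux WITHOUT the time order `s < t` ("far somewhere and close somewhere"). -/
def NoDeepReturnWithoutOrder : Prop :=
  ∀ (D : DobrushinDomain) (a b : ℝ → Site 2), IsEndpointApprox D a b →
    ∀ ε : ℝ, 0 < ε → ∀ η : ℝ, 0 < η → ∃ r : ℝ, 0 < r ∧ ∀ᶠ δ in 𝓝[>] (0 : ℝ),
      law D.carrier δ (a δ) (b δ) {γ | ∃ s t : unitInterval,
        ε ≤ dist (γ.walk.toCurve (meshPoint δ) s) (D.pt 0) ∧
        dist (γ.walk.toCurve (meshPoint δ) t) (D.pt 0) ≤ r} ≤ ENNReal.ofReal η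

/-- **Any proof must use the time order**: without it the statement is false — in fact for EVERY
admissible datum (`(s,t) = (1,0)`: end far, start close; landed
`noDeepReturn_false_without_order`). [folklore] -/
theorem noDeepReturn_false_without_order : ¬ NoDeepReturnWithoutOrder := by
  intro h
  obtain ⟨D⟩ := (inferInstance : Nonempty DobrushinDomain)
  obtain ⟨A, B, hAB⟩ := exists_isEndpointApprox D
  exact Theorems.NoDeepReturn.Negative.noDeepReturn_false_without_order D A B hAB (h D A B hAB)

/-- The crux with `0 < ε` weakened to `0 ≤ ε`. -/
def NoDeepReturnWithEpsNonneg : Prop :=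
  ∀ (D : DobrushinDomain) (a b : ℝ → Site 2), IsEndpointApprox D a b →
    ∀ ε : ℝ, 0 ≤ ε → ∀ η : ℝ, 0 < η → ∃ r : ℝ, 0 < r ∧ ∀ᶠ δ in 𝓝[>] (0 : ℝ),
      law D.carrier δ (a δ) (b δ) (deepReturn D.carrier δ (a δ) (b δ) (D.pt 0) ε r)
        ≤ ENNReal.ofReal η

/-- **Any proof must use `ε > 0`**: at `ε = 0` every walk is `r`-close to `a` at a positive time
(intermediate value of `t ↦ dist (poly γ t) a`; landed `noDeepReturn_false_with_eps_zero`). [folklore] -/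
theorem noDeepReturn_false_with_eps_nonneg : ¬ NoDeepReturnWithEpsNonneg := by
  intro h
  obtain ⟨D⟩ := (inferInstance : Nonempty DobrushinDomain)
  obtain ⟨A, B, hAB⟩ := exists_isEndpointApprox D
  exact Theorems.NoDeepReturn.Negative.noDeepReturn_false_with_eps_zero D A B hAB (h D A B hAB)

/-- The crux with the two endpoint LIMITS dropped (eventual reachability kept). -/
def NoDeepReturnWithoutEndpointLimits : Prop :=
  ∀ (D : DobrushinDomain) (a b : ℝ → Site 2),
    (∀ᶠ δ in 𝓝[>] (0 : ℝ), (discreteDomainGraph D.carrier δ).Reachable (a δ) (b δ)) →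
    ∀ ε : ℝ, 0 < ε → ∀ η : ℝ, 0 < η → ∃ r : ℝ, 0 < r ∧ ∀ᶠ δ in 𝓝[>] (0 : ℝ),
      law D.carrier δ (a δ) (b δ) (deepReturn D.carrier δ (a δ) (b δ) (D.pt 0) ε r)
        ≤ ENNReal.ofReal η

/-- **Any proof must use the endpoint limits** (earlier seat, landed
`sawReversalUpgrade_noDeepReturn_false_without_endpointLimits`: swapped approximation, the walk
ends at `a`). [folklore] -/
theorem noDeepReturn_false_without_endpointLimits : ¬ NoDeepReturnWithoutEndpointLimits :=
  sawReversalUpgrade_noDeepReturn_false_without_endpointLimits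

/-! ## §2 (b) Tightness of the conclusion -/

/-- **An admissible radius is below the chord**: if the crux's bound holds at `(ε, η, r)` with
`ε < dist a b`, `η < 1`, then `r < dist a b` (landed `r_lt_dist_of_noDeepReturnBound`). With
`not_noDeepReturn_uniformInEps` (§3) this says: `r` genuinely shrinks with `ε`. [folklore] -/
theorem crux_radius_lt_dist (D : DobrushinDomain) (a b : ℝ → Site 2) (hab : IsEndpointApprox D a b)
    {ε η r : ℝ} (hε : 0 < ε) (hεd : ε < dist (D.pt 0) (D.pt 1)) (hη : η < 1)
    (h : ∀ᶠ δ in 𝓝[>] (0 : ℝ),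
      law D.carrier δ (a δ) (b δ) (deepReturn D.carrier δ (a δ) (b δ) (D.pt 0) ε r)
        ≤ ENNReal.ofReal η) :
    r < dist (D.pt 0) (D.pt 1) :=
  r_lt_dist_of_noDeepReturnBound D a b hab hε hεd hη h

/-! ## §3 (c) Natural strengthenings -/

/-- S: the radius chosen BEFORE the scale (`∃ r ∀ ε`). -/
def NoDeepReturnUniformInEps : Prop :=
  ∀ (D : DobrushinDomain) (a b : ℝ → Site 2), IsEndpointApprox D a b →
    ∀ η : ℝ, 0 < η → ∃ r : ℝ, 0 < r ∧ ∀ ε : ℝ, 0 < ε → ∀ᶠ δ in 𝓝[>] (0 : ℝ),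
      law D.carrier δ (a δ) (b δ) (deepReturn D.carrier δ (a δ) (b δ) (D.pt 0) ε r)
        ≤ ENNReal.ofReal η

/-- **FALSE** (for every admissible datum): with `ε := c/2`, `c := min r (|b−a|/2)`, every walk
crosses the levels `c/2` then `c ≤ r` (landed `not_noDeepReturn_uniformInEps`). [folklore] -/
theorem not_noDeepReturnUniformInEps : ¬ NoDeepReturnUniformInEps := by
  intro h
  obtain ⟨D⟩ := (inferInstance : Nonempty DobrushinDomain)
  obtain ⟨A, B, hAB⟩ := exists_isEndpointApprox D
  exact Theorems.NoDeepReturn.Negative.not_noDeepReturn_uniformInEps D A B hAB (h D A B hAB)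

/-- S: all meshes `δ > 0` instead of all SMALL meshes. -/
def NoDeepReturnAllMesh : Prop :=
  ∀ (D : DobrushinDomain) (a b : ℝ → Site 2), IsEndpointApprox D a b →
    ∀ ε : ℝ, 0 < ε → ∀ η : ℝ, 0 < η → ∃ r : ℝ, 0 < r ∧ ∀ δ : ℝ, 0 < δ →
      law D.carrier δ (a δ) (b δ) (deepReturn D.carrier δ (a δ) (b δ) (D.pt 0) ε r)
        ≤ ENNReal.ofReal η

/-- **FALSE**: unit disc, meshes `δ ∈ [1/4, 1/2)` where the endpoint approximation is unconstrained
and the lattice vertex `2δ` sweeps to `1 = D.pt 0` (landed `not_noDeepReturn_allMesh`). The crux's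
`∀ᶠ δ` is load-bearing (cf. negative stmt-0772, ALL-δ tightness). [folklore] -/
theorem not_noDeepReturnAllMesh : ¬ NoDeepReturnAllMesh :=
  Theorems.NoDeepReturn.Negative.not_noDeepReturn_allMesh

/-- S⁺₁ of the census: the radius UNIFORM over Dobrushin domains and endpoint approximations. -/
def NoDeepReturnUniformInDomain : Prop :=
  ∀ ε : ℝ, 0 < ε → ∀ η : ℝ, 0 < η → ∃ r : ℝ, 0 < r ∧
    ∀ (D : DobrushinDomain) (a b : ℝ → Site 2), IsEndpointApprox D a b →
      ∀ᶠ δ in 𝓝[>] (0 : ℝ),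
        law D.carrier δ (a δ) (b δ) (deepReturn D.carrier δ (a δ) (b δ) (D.pt 0) ε r)
          ≤ ENNReal.ofReal η

/-- S⁺₁ implies the crux (so refuting S⁺₁ is only a warning to provers: no proof may produce a
domain-independent `r`). [folklore] -/
theorem crux_of_uniformInDomain (h : NoDeepReturnUniformInDomain) : Crux := by
  intro D a b hab ε hε η hη
  obtain ⟨r, hr, hall⟩ := h ε hε η hη
  exact ⟨r, hr, hall D a b hab⟩

/-- **NEAR-MISS (false on paper, not formalised): S⁺₁ is false by FJORDS.** Witness family: given
`ε = 1/8`, `η = 1/2` and the adversary's `r`, the polygonal Jordan domain `D_r` = unit square with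
`a` = midpoint of its bottom side, from which a corridor of width `w = r/8` (walls of width `w`)
starts inside `B(a, r/2)`, leaves `B(a, 1/4) ⊇ B(a, 2ε)`, and returns inside `B(a, r/2)`, where it
dead-ends at `b := D.pt 1` (a boundary point of the corridor's end). Every lattice path of
`(D_r)_δ` from `a_δ` to `b_δ`, `δ < w`, runs through the corridor (mesh edges are closed segments in
`closure D`, they cannot cross a wall of width `> δ`), hence is `2ε`-far and LATER `r/2`-close: the
deep-return event is everything, law `1 > 1/2`. Obstruction to a kernel proof: COST only — an
explicit `polygonDomain` (≈ 12 vertices, `IsSimpleClosedPolygon` by hand), its `meshDomain`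
(largest component) and the discrete "every path uses the corridor" separation argument; none of it
is mathematics in doubt (census S⁺₁, rattack remark). Why the crux survives: a FIXED Jordan boundary is
uniformly locally connected, so below some `r₀(D, ε)` no return is forced. [folklore] -/
theorem not_noDeepReturnUniformInDomain : ¬ NoDeepReturnUniformInDomain := by
  sorry

/-! ## §5 (e) The PICKED line `SketchIdeator2` — its atom `RootLocalisation` is predicted false

Definitions copied VERBATIM from `Cruxes/NoDeepReturn/SketchIdeator2.lean` (namespace `…Ideator2`;
that file carries `sorry`s and is not imported). -/

/-- [Ideator2] far walks `y → v`: some vertex at distance `≥ ε` from `c`. -/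
def farSet (Ω : Set ℂ) (δ : ℝ) (y v : Site 2) (c : ℂ) (ε : ℝ) : Set (DomainSAW Ω δ y v) :=
  {γ | ∃ j ≤ γ.walk.length, ε ≤ dist (meshPoint δ (γ.walk.getVert j)) c}

/-- [Ideator2] `A`-confined walks `y → v`. -/
def confSet (Ω : Set ℂ) (δ : ℝ) (y v : Site 2) (A : Site 2 → Prop) : Set (DomainSAW Ω δ y v) :=
  {γ | ∀ j ≤ γ.walk.length, A (γ.walk.getVert j)}

/-- [Ideator2] Stolz vertex of the root ball: within `ρ` of `a` and with clearance `≥ κ ·` distance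
to the root vertex. -/
def InStolz (D : DobrushinDomain) (δ : ℝ) (a₀ : Site 2) (κ ρ : ℝ) (v : Site 2) : Prop :=
  dist (meshPoint δ v) (D.pt 0) ≤ ρ ∧
    κ * dist (meshPoint δ v) (meshPoint δ a₀) ≤ Metric.infDist (meshPoint δ v) D.carrierᶜ

/-- [Ideator2] Stolz vertices joined to the root vertex through Stolz vertices. -/
def StolzReach (D : DobrushinDomain) (δ : ℝ) (a₀ : Site 2) (κ ρ : ℝ) (y : Site 2) : Prop :=
  ∃ p : (discreteDomainGraph D.carrier δ).Walk y a₀, ∀ w ∈ p.support, InStolz D δ a₀ κ ρ w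

/-- [Ideator2] **THE ATOM** of the picked line. -/
def RootLocalisation : Prop :=
  ∀ (D : DobrushinDomain) (a : ℝ → Site 2),
    Tendsto (fun δ => meshPoint δ (a δ)) (𝓝[>] (0 : ℝ)) (𝓝 (D.pt 0)) →
    ∀ κ : ℝ, 0 < κ → κ < 1 → ∀ ε : ℝ, 0 < ε → ∀ η : ℝ, 0 < η → ∃ r₀ : ℝ, 0 < r₀ ∧
      ∀ ρ : ℝ, 0 < ρ → ρ ≤ r₀ → ∀ᶠ δ in 𝓝[>] (0 : ℝ),
        ∀ y : Site 2, StolzReach D δ (a δ) κ ρ y →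
          weight D.carrier δ y (a δ) (farSet D.carrier δ y (a δ) (D.pt 0) ε)
            ≤ ENNReal.ofReal η *
              weight D.carrier δ y (a δ) (confSet D.carrier δ y (a δ) (StolzReach D δ (a δ) κ ρ))

/-- A Stolz-reachable vertex is itself a Stolz vertex (it heads its own connecting walk). [folklore] -/
theorem inStolz_of_stolzReach {D : DobrushinDomain} {δ : ℝ} {a₀ : Site 2} {κ ρ : ℝ} {y : Site 2}
    (h : StolzReach D δ a₀ κ ρ y) : InStolz D δ a₀ κ ρ y := by
  obtain ⟨p, hp⟩ := h
  exact hp y p.start_mem_support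

/-- **Kernel fact behind the rim defect: confined remainders never leave the CLOSED `ρ`-ball.**
Every vertex of a walk in `confSet … (StolzReach D δ a₀ κ ρ)` is within `ρ` of `a = D.pt 0`. So for
an entrance vertex `y` on the rim (`dist (δy) a ∈ (ρ − δ, ρ]`, which `∀ y` includes and which is
exactly where first entrances sit in the glue), EVERY confined walk starts on the boundary of its
allowed region. [folklore] -/
theorem confSet_stolzReach_subset_ball {D : DobrushinDomain} {δ : ℝ} {a₀ y : Site 2} {κ ρ : ℝ}
    {γ : DomainSAW D.carrier δ y a₀}
    (hγ : γ ∈ confSet D.carrier δ y a₀ (StolzReach D δ a₀ κ ρ)) :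
    ∀ j ≤ γ.walk.length, dist (meshPoint δ (γ.walk.getVert j)) (D.pt 0) ≤ ρ :=
  fun j hj => (inStolz_of_stolzReach (hγ j hj)).1

/-- In particular the entrance vertex of a confined walk is itself in the closed ball (`j = 0`).
[folklore] -/
theorem dist_le_of_confSet_nonempty {D : DobrushinDomain} {δ : ℝ} {a₀ y : Site 2} {κ ρ : ℝ}
    (h : (confSet D.carrier δ y a₀ (StolzReach D δ a₀ κ ρ)).Nonempty) :
    dist (meshPoint δ y) (D.pt 0) ≤ ρ := by
  obtain ⟨γ, hγ⟩ := h
  simpa using confSet_stolzReach_subset_ball hγ 0 (Nat.zero_le _)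

/-- **NEAR-MISS (predicted false; NOT kernel-provable with present tools): the atom
`RootLocalisation` fails for every admissible `(D, a)`, every `κ`, at every radius `ρ`.**

Heuristic refutation (standard SAW scaling, exponents of Nienhuis / Lawler–Schramm–Werner; only
`x₁ᵇ > x₁` is used, i.e. that a boundary-anchored SAW end is polynomially suppressed against a bulk
end — `γ₁ = 61/64 < γ = 43/32`, overwhelming numerical support):
* Fix `D, a, κ, ε, η`, let the prover choose `r₀`, take any `ρ ≤ r₀` and let `δ → 0`. Pick `y` in the
  Stolz entrance set ON ITS RIM: `dist (δy, a) ∈ (ρ − δ, ρ]`, clearance `≥ κρ/2` (such `y` exist and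
  are Stolz-joined to `a_δ` along the inward ray, for every `D` — the germ of `D` at `a` contains the
  image of a half-disc). Write `Z(y)`, `F(y)`, `C(y)` for the total / far / confined `x_c`-masses of
  walks `y → a_δ`.
* `F(y)/Z(y) → p(ρ/ε) > 0`: under the normalised two-point law `y → a_δ` an excursion to `∂B(a, ε)`
  is a macroscopic shape event whose probability has a positive `δ → 0` limit (all `δ`-dependence
  sits in the root-end vertex factor common to `F` and `Z`).
* `C(y)/Z(y) ≲ (δ/ρ)^{x₁ᵇ − x₁ + o(1)} = (δ/ρ)^{25/48+o(1)} → 0`: by `confSet_stolzReach_subset_ball`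
  a confined walk stays in `B̄(a, ρ)`, and `y` is within one lattice step of that sphere, so the walk's
  `y`-end is a BOUNDARY end (half-plane through `y`) instead of a bulk end: entropic penalty
  `n^{γ₁−γ} = n^{−25/64}`, `n ≍ (ρ/δ)^{4/3}`.
* Hence `F(y)/C(y) → ∞` and `F(y) ≤ η C(y)` fails for all small `δ`: the atom is false at EVERY
  `ρ ≤ r₀`. The defect is intrinsic to single-scale cutting: in the glue
  (`FirstEntranceFarBound` with `A := StolzReach … κ ρ`) the relevant `y` ARE first-entrance vertices,
  i.e. rim vertices.
Repairs examined: (i) two radii WITH Stolz confinement (enter at `ρ`, confine to `StolzReach κ' (2ρ)`):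
still predicted false — the remainder must approach the root non-tangentially at every scale between
`ρ` and `d₀ = |δ a_δ − a| → 0`, cost `(d₀/ρ)^{c(κ')} → 0` with `c(κ') > 0` (chordal SLE₈⸝₃ from a
boundary point exits every Stolz cone at arbitrarily small scales a.s.: scaling + Blumenthal 0–1),
against the `δ`-free far cost; (ii) two radii WITHOUT Stolz (confine to `D ∩ B̄(a, 2ρ)`): plausible
(`C₂/Z → q > 0`, `F/Z → p(ρ/ε)` small) but then `A`-confined walks no longer avoid the first-entrance
prefix for free (the prefix may occupy `B(a,2ρ) ∖ A`, collar included), and the needed lower bound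
"remainders confined to `B̄(a,2ρ)` AND avoiding the prefix `≥ c·Z`, uniformly over prefixes" is a
past-conditional statement — obstruction (α) of the census (no BK / no free gluing at `x_c`).
Obstruction to a kernel proof of `¬ RootLocalisation`: it needs a LOWER bound on a critical far
two-point mass (`F`) against an UPPER bound on a confined one (`C`); in tree only Hammersley–Welsh
(`Zd.exp_mul_pow_le_bridgeCount`, loses `e^{−C√n}`) and trivial single-walk bounds exist, and the
purely combinatorial route (a thin winding Stolz corridor longer than the far route) is blocked by
the covering bound `length(Stolz corridor ∩ B(a,t)) ≤ C t/κ < 2ε` once `r₀ ≪ κ ε`. [folklore] -/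
theorem rootLocalisation_predictedFalse : ¬ RootLocalisation := by
  sorry

/-! ## §6 Why the crux resists (briefing for provers and the lead)

* It is a NECESSARY condition of the conjunct (`noDeepReturn_of_sawScalingLimit`), and every typed
  strengthening with teeth is false (S⁺₁ uniform in `D`: fjords; `∃ r ∀ ε`; `∀ δ > 0`; sup-form
  first-entry penetration `RootPenetrationSupAt`: finger + junction near-touch + start gap, census
  S⁺₃) or is the crux in costume (annealed first-entry ratio, census D1).
* The honest content is a `δ`-UNIFORM UPPER bound on a ratio of two doubly-pinned `x_c`-partition
  functions at the marked prime end (boundary 3-leg / out–in–out at `a`; predicted `(r/ε)^{7/2}` at a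
  flat point). No tool on `ℤ²` at `n = 0`: no RSW/FKG/BK, no observable (barriers
  `ParafermionicHalfCauchyRiemann`, `NienhuisWeightsExcludeVertexSAW`), no random-walk coupling
  (`SAWNotKineticallyGrown`), no length-fair surgery at `x_c` (connector `x_c^{L/δ}` vs polynomial
  multiplicity), and even the lattice-local regime needs `Σ n pₙ μ^{-n} < ∞` (open in `d = 2`,
  stmt-7117 class). The hexagonal twin `stub_noLateReturn` is open WITH the parafermion.
* The picked line's atom is false as typed (§5) and its Stolz device is intrinsically `δ`-costly; a
  retyping that keeps the atom plausible (fat two-scale confinement) gives up the free avoidance that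
  made the line attractive. Recommendation to the lead: do not spend cycles proving
  `FirstEntranceFarBound`/`PolylineToVertex` FOR this atom; if the line is kept, re-type the atom at
  two radii without Stolz and add the past-conditional avoidance lower bound as an explicit (open)
  stub — i.e. census D1 with its open piece named, not hidden.
* A counterexample to the crux would need boundary near-touches / self-pinches to be TYPICAL at `x_c`
  uniformly in `δ` (a lower bound), opposite to the predicted exponents (boundary one-arm 2, tip 1)
  and to the hexagonal numerics recorded under `Cruxes/HexTight/NOTES.md §E`.
-/

end Summit.CriticalPhenomena.SAWScalingLimit.Cruxes.NoDeepReturn.Disproof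

end
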